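import Mathlib
import HarnessLib
import HarnessLib.Audit
import Summits.KontsevichZagierPeriods.Statement
import HarnessLib.Audit.Status.Attr

/-!
Route: ValuedFieldSpecialisation

Route ValuedFieldSpecialisation (idea card valued-field-regularised-specialisation). It suffices to
show X := CTConstruction ∧ ParametricLifting.
CTConstruction ("regularised specialisation is a functor"): there is an additive constant-term map
CT : KZ.FormalRep →+ KZ.FormalRep on families of integral representations (an (n+1)-dimensional
representation R read as the family of its slices over the parameter s = z 0, s → 0⁺) such that
(CT1) eval (CT [R]) is the constant term c₀₀ of the log-power asymptotic expansion I_R(s) = Σ w_i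
s^{a_i}(log s)^{b_i} + c₀₀ + o(1) of the slice integrals whenever such an expansion exists
(Comte–Lion–Rolin); (CT2) CT sends every FIBRED move (domain/integrand additivity, change of
variables preserving z 0, Newton–Leibniz along a fibre coordinate) into KZ.relations; (CT3) CT of a
dominated family is move-equivalent to its special fibre. Intended construction: Yin's measured
Hrushovski–Kazhdan integral of the generic fibre over the real closed valued field ℝ((t^ℚ))
(RES-classes = real semialgebraic sets up to unit-Jacobian bijections and null sets = rules
(1a),(2)), read at Γ-weight t⁰(log t)⁰, compared with Kaiser's 𝓟[log 1/t]-valued semialgebraic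
measure.
ParametricLifting (open core): every pair of equal-valued rational representations is the special
fibre of a fibred relation, i.e. there is G in the subgroup generated by fibred moves which is a
ℤ-combination of dominated families whose special fibres sum to [r] − [r'] modulo KZ.relations
(divergent intermediates allowed inside G).
Lean: X = CTConstruction ∧ ParametricLifting, both `def … : Prop` over
Literature.NumberTheory.Transcendental.KZ.{IntegralRep, FormalRep, of, eval, relations,
domainAddRel, integrandAddRel, newtonLeibnizRel},
Literature.NumberTheory.Transcendental.IsSemialgebraicMapOn and Mathlib (Filter.Tendsto, nhdsWithin,
Real.log, rpow, AddSubgroup.closure); elaborated in Sketch.lean (lean check rc 0). Assembly: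
CTConstruction → ParametricLifting → KontsevichZagierPeriods (pure algebra: CT G ∈ relations by CT2,
CT G ≡ [r] − [r'] by CT3 and additivity).

Rationale: WHY THIS LINE. Every positive route on this summit stalls at a LIMIT with divergent intermediates
(regularised double shuffle, k→0 in Legendre, base-point constants of parametric chains; route Neg
pressure point (a)); finite move chains cannot take limits. This route replaces the limit by a
change of FIELD: the degenerating parameter s becomes the infinitesimal t of the real closed valued
field K = ℝ((t^ℚ)) (T-convex, VandendriesLewenberg1995), where Yin2018TConvexIntegration Thm 5.28
gives a canonical isomorphism ∫₊ : K₊µVF[*] → K₊µRV[*]/µIsp whose defining relations are additivity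
+ definable bijections with RV-Jacobian + discarding lower-dimensional sets — rules (1a),(2) over K
— and whose residue-field side consists of real ℚ-semialgebraic sets with forms
(HrushovskiKazhdan2006 §8 is the ACVF original). Kaiser2017 (Thm 5.1 transformation formula, 5.2
dominated convergence, 5.7 FTC; range 𝓟[X], X = log 1/t, built from ComteLionRolin2000 /
LionRolin1998 / CluckersMiller2011 expansions) is the VALUE-level theory: rules 1–3 hold over the
Puiseux field and the t⁰X⁰-coefficient is additive. The bet (the card's graded JOIN): the t⁰(log t)⁰
part of the motivic volume lifts the regularised value from a NUMBER to a CLASS in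
FormalRep/relations, functorially in fibred move chains — Ayoub2015's "specialise the generic fibre"
with the formal disc replaced by a valued real closed field and motives by quantifier elimination
(his Rem. 1.12 asks for an elementary engine); DucrosHrushovskiLoeser2023 §8 is the model
archimedean/non-archimedean comparison and the warning that Γ-classes alone see only leading
asymptotics, so the comparison must run through Kaiser's full measure. Imported area: model theory
of valued fields / motivic integration, with the explicit dictionary RV-Jacobian ↦ rule (2),
additivity ↦ rule (1), RES-class ↦ representation, Γ-weight ↦ order s^a(log s)^b, t⁰-part ↦
regularised value, choice of t ↦ tangential base point (CT is not invariant under s ↦ 2s,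
correctly).
RANKED CRUXES. #2 CTConstruction — ∃ CT : FormalRep →+ FormalRep with (CT1) values = constant term
of the slice expansion when it exists, (CT2) fibred move generators ↦ KZ.relations, (CT3) dominated
families ↦ special fibre (why it might fail: K₊µRV/µIsp or Yin's special covariant bijections may
identify more than rules (1),(2), so CT lands only in FormalRep/ker eval — an ambiguity witness is
an element of ker eval ∖ relations; sources Yin2018TConvexIntegration, HrushovskiKazhdan2006,
Kaiser2017). #3 ClassLevelExpansion — CT-free existence half: every family is fibred-move-equivalent
to a ℤ-combination of elementary divergent products s^{-p/q}(log 1/s)^b × [r] plus a dominated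
combination, a class-valued Comte–Lion–Rolin theorem (why it might fail: reaching the normal form in
fibre dimension ≥ 2 may need un-nesting by non-semialgebraic primitives — HK integrate cell-by-cell
with CLASS-valued inner integrals and transferring that trick to FormalRep is the point; sources
ComteLionRolin2000, CluckersMiller2011, HrushovskiKazhdan2006). #4 ConstantTermsArePeriods — value
shadow implied by #2 and by #3: constant terms of semialgebraic period families are ℤ-combinations
of periods (why it might fail: Comte–Lion–Rolin coefficients come from preparation with subanalytic
units and might escape ℚ-semialgebraic data; sources ComteLionRolin2000, Kaiser2017,
KontsevichZagier2001). #5 ParametricLifting — open core ≈ Conjecture 1 (implied by it with G = 0):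
every equal-valued rational pair is the special fibre of a fibred relation whose net support is
dominated (why it might fail: GPC-strength in general, strength barriers apply; sources
KontsevichZagier2001, Ayoub2015, AyoubRelKZRevisited).
KILL CRITERIA. Refuting #2 by an explicit ambiguity (two fibred normal forms of one family with
move-inequivalent t⁰-classes) closes the route `refuted:CTConstruction` and hands route Neg a
kernel-conjecture witness candidate; refuting #3 already in fibre dimension 1 (support item
ClassLevelExpansionFibreDimOne) closes the route — the dictionary is wrong at its first step;
refuting #4 kills the specialisation philosophy of all three families cards at once; refuting #5
refutes the summit. #3 proved but #2 refuted ⇒ pivot to a value-level route (CT into FormalRep/ker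
eval) that still serves ExpConservative/Grothendieck as a regularisation lemma.
NOT DECOMPOSED YET. No split of #2 into existence (#3) + uniqueness + realisation K₊µRES →
FormalRep/relations until #3 or #4 closes; no sector instances of #5 (stuffle for ζ(2)², Legendre
k→0, Euler ζ(2,1)) — they overlap Grothendieck items 0275/0280 and the sibling cards' calibrations
and will ride as --supports lemmas; no Literature vocabulary for T-convex valued fields /
Grothendieck semirings requested (thesis-size; only if #3 closes and #2 needs Yin's theorem as a
named fact).
CHEAPEST FALSIFIER. Fibre dimension 1, by hand or kit: take R_s = ([0,1], 1/((x+s)(x+2))) and R'_s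
obtained from it by the fibred substitution x ↦ x/(1+x) composed with domain splitting at x = s;
compute both class-level normal forms (elementary log part + dominated remainder) and check that the
two t⁰-classes are move-equivalent BY INSPECTION (both should be [([0,1], explicit rational)] with
value (log 2 − log 3)/2-type numbers). Any pair of 1-dimensional families where the two remainders
have equal value but visibly need Baker-type input to be identified signals that CT2 forces CT into
FormalRep/ker eval only — run this before anything else. Literature lookup that would downgrade #4
to known: a printed statement that Comte–Lion–Rolin constant terms of semialgebraic families are
periods (searched crossref/zbMATH/galaxy this session: not found).
DEFINITION REQUESTS. Three notions are inlined in every signature and requested as Theorems-side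
definitions so a tenure pass can restate compactly: KZ.fibredRelations (AddSubgroup.closure of the
fibred generators), KZ.sliceValue / KZ.HasConstantTerm (slice integral over z 0 = s and the
divergent-monomial expansion predicate, with uniqueness lemma), KZ.IsDominatedFamily (domination +
a.e. special fibre, with the dominated-convergence lemma).
SUPPORT. FibredRelationsLeRelations (provable now, ~20 lines), ConstantTermUnique (provable now,
asymptotic scale), DominatedSliceTendsto (provable now, dominated convergence along nhdsWithin),
ClassLevelExpansionFibreDimOne (#3 with n = 1: Puiseux/semialgebraic preparation in two variables;
calibration of the encodings — an encoding defect surfaces here first and is reported for restate,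
not counted as a refutation of the line).

Novelty: NEAREST PRIOR ART (searched this session: crossref "Hrushovski Kazhdan integration valued fields",
"Yin integration power-bounded T-convex", "Kaiser Lebesgue measure non-archimedean real closed",
"Comte Lion Rolin", "Ducros Hrushovski Loeser"; zbMATH "Yin T-convex valued fields integration"; lit
frontier KontsevichZagierPeriods --since 2020 (hit: DupontPanzerPym2026 regularised integrals/log
corners); lit galaxy search "Hrushovski-Kazhdan" --star all (Cluckers–Nicaise–Sebag LMS volumes, R.
Dale notes; nothing on periods); materialised and read: Yin2018TConvexIntegration pp.2–4, 32 (Thm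
5.28/5.29), Kaiser2017 pp.2–3, 19–23 (range 𝓟[X]; Thm 5.1, 5.2, 5.7; §5.3 Fubini partial),
DucrosHrushovskiLoeser2023 §8; plus the card's novelty audit (refuter-novelty-audit-3: Yin
arXiv:1808.07129 = the card's crux (1); Kaiser arXiv:1409.2241 = value-level (M1)–(M2)).
- Yin2018TConvexIntegration (arXiv:1808.07129, preprint) Thm 5.28: measured HK isomorphism for
power-bounded T-convex valued fields with RV-volume forms — the class-level ENGINE; no periods, no
archimedean comparison, no KZ calculus.
- Kaiser2017 (doi:10.1112/plms.12070): semialgebraic Lebesgue measure/integral on the Puiseux field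
with values in 𝓟[X], transformation formula, dominated convergence, FTC — the VALUE-level functor
(constant term = a number), defined from ComteLionRolin2000.
- Ayoub2015 / AyoubRelKZRevisited: relative KZ over a formal disc, motivic proof; in-tree route
AyoubSpecialisation pivoted away (relative theo  [refs: 10.1112/plms.12070, 10.5802/jep.335, 1808.07129, 1409.2241, doi:10.1112/plms.12070, doi:10.5802/jep.335, DupontPanzerPym2026, Kaiser2017, DucrosHrushovskiLoeser2023, ComteLionRolin2000, Ayoub2015]

Barriers (technique_class: motivic-integration valued-RCF regularised-specialisation): - technique_class: motivic-integration valued-RCF regularised-specialisation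
- Literature.Barriers.KontsevichZagierPeriods.noSemialgebraicPrimitive_inv_sub_two: EVADED by design
and simultaneously the honest risk of crux #3 — CT and the class-level expansion never take a
primitive in a fibre variable (HK/Yin integrate cell-by-cell with CLASS-valued inner integrals: the
inner integral is an RV-class, not a function, so no logarithmic primitive is ever named); the only
Newton–Leibniz instances the normal form itself uses are along padding coordinates with polynomial
primitives (u ↦ u·f). If the normal form in fibre dimension ≥ 2 turns out to need fibrewise
un-nesting, the barrier bites and #3 fails there (dimension 1 is Puiseux preparation and safe).
- Literature.Barriers.KontsevichZagierPeriods.kzConjecture_implies_oddZetaAlgIndep: NOT ENGAGED by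
#2–#4 (transcendence-free statements about the calculus; #2 is implied by KZKernelConjecture + #4 +
Comte–Lion–Rolin existence, #3/#4 assert no identity between given numbers); ENGAGED by #5 (≈
Conjecture 1): it does not evade it; the bet is that #5 is attacked sector by sector where the
functional identity is already a theorem (regularised double shuffle, Legendre), this route
supplying only the specialisation step.
- Literature.Barriers.KontsevichZagierPeriods.kzConjecture_implies_twoPiI_log_algIndep: same as the
previous line — only #5 has conjecture strength.
- Literature.Barriers.KontsevichZagierPeriods.kzConjecture_implies_ellip

History (route lifecycle, newest last):
- 2026-08-15T11:20:56Z · rev 1: restated Target (stmt-KontsevichZagierPeriods-3494) — restate Target (commuted conjunction) so it re-renders now that CTConstruction and ParametricLifting exist in the file; at open it was rendered before them and (planner-plancard-KontsevichZagierPeriods-Kont-acef51be-0)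
- 2026-08-15T11:21:27Z · rev 2: dropped Target — drop the optional Target item: it only restates X = CTConstruction ∧ ParametricLifting, both of which are items, and a rank-0 item referring to same-file decls (planner-plancard-KontsevichZagierPeriods-Kont-acef51be-0)

sub-problem: KontsevichZagierPeriods · status: open · opened planner-plancard-KontsevichZagierPeriods-Kont-acef51be-0 2026-08-15T11:19:01Z · rev 3 · ledger route-KontsevichZagierPeriods-ValuedFieldSpecialisation
GENERATED by the gate from the ledger (D-0016/17). Provers cite these decls: `theorem foo : Summit.KontsevichZagierPeriods.KontsevichZagierPeriods.Theses.ValuedFieldSpecialisation.<Decl> := …` in Summits/KontsevichZagierPeriods/KontsevichZagierPeriods/Theorems/<Name>.lean.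
-/

namespace Summit.KontsevichZagierPeriods.KontsevichZagierPeriods.Theses.ValuedFieldSpecialisation

open scoped BigOperators Topology Manifold Classical MeasureTheory ProbabilityTheory Matrix InnerProductSpace ComplexConjugate ContinuousMap
open Filter Set Function TopologicalSpace MeasureTheory

attribute [summit_statement] _root_.KontsevichZagierPeriods

open Literature Periods

/-- item stmt-KontsevichZagierPeriods-3495 · crux · rank 2 · open · by planner
why it might fail: K₊µRV/µIsp (Yin's special covariant bijections, the ideal (P)) may identify more than rules (1a),(2) do, so a well-defined CT lands only in FormalRep/ker(eval); value group ℚ and the Yin→Kaiser class/value comparison are unbuilt.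
sources: Yin2018TConvexIntegration, HrushovskiKazhdan2006, Kaiser2017, Yin2017, DucrosHrushovskiLoeser2023, Ayoub2015
[crux] THE THESIS-BEARING ITEM. There is an additive map CT : KZ.FormalRep →+ KZ.FormalRep
('constant-term / regularised-specialisation functor'; an (n+1)-dim representation R is read as the
family of its slices over s = z 0, s → 0⁺; what CT does on generators irrelevant near 0⁺ is
unconstrained) with: (CT1) whenever the slice integral I_R(s) = ∫_{x : (s,x) ∈ R.domain}
R.integrand(s,x) admits an expansion I_R(s) = Σ_i w_i s^{a_i} (log s)^{b_i} + c + o(1) over finitely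
many DIVERGENT monomials (a_i < 0, or a_i = 0 < b_i; a_i ∈ ℚ), eval (CT [R]) = c (c is unique:
support item ConstantTermUnique; existence of the expansion for every ℚ-semialgebraic R is
Comte–Lion–Rolin / Cluckers–Miller and is NOT demanded); (CT2) CT maps every FIBRED move generator —
domain additivity, integrand additivity (all instances), change of variables Φ with Φ z 0 = z 0
(same data as KZ.changeOfVariablesRel), Newton–Leibniz along the last coordinate with base dimension
≥ 1 — into KZ.relations; (CT3) if R is DOMINATED near s = 0⁺ by an integral representation g in the
fibre variables (|R.integrand (s,x)| ≤ g x, fibre of R inside g.domain, for 0 < s < ε) and has the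
a.e. special fibre r₀ (indicator and integra -/
@[route_item "route-KontsevichZagierPeriods-ValuedFieldSpecialisation", crux]
def CTConstruction : Prop :=
  ∃ CT : Literature.NumberTheory.Transcendental.KZ.FormalRep →+ Literature.NumberTheory.Transcendental.KZ.FormalRep, (∀ (n : ℕ) (R : Literature.NumberTheory.Transcendental.KZ.IntegralRep (n + 1)) (c : ℝ), (∃ (k : ℕ) (a : Fin k → ℚ) (b : Fin k → ℕ) (w : Fin k → ℝ), (∀ i, a i < 0 ∨ (a i = 0 ∧ 0 < b i)) ∧ Filter.Tendsto (fun s : ℝ => (∫ x in {x : Fin n → ℝ | Matrix.vecCons s x ∈ R.domain}, R.integrand (Matrix.vecCons s x)) - ∑ i, w i * s ^ ((a i : ℚ) : ℝ) * Real.log s ^ (b i)) (nhdsWithin 0 (Set.Ioi 0)) (nhds c)) → Literature.NumberTheory.Transcendental.KZ.eval (CT (Literature.NumberTheory.Transcendental.KZ.of R)) = c) ∧ (∀ c ∈ (Literature.NumberTheory.Transcendental.KZ.domainAddRel ∪ Literature.NumberTheory.Transcendental.KZ.integrandAddRel ∪ {c | ∃ (n : ℕ) (r r' : Literature.NumberTheory.Transcendental.KZ.IntegralRep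 (n + 1)) (Φ : (Fin (n + 1) → ℝ) → (Fin (n + 1) → ℝ)) (Φ' : (Fin (n + 1) → ℝ) → (Fin (n + 1) → ℝ) →L[ℝ] (Fin (n + 1) → ℝ)), Literature.NumberTheory.Transcendental.IsSemialgebraicMapOn ℚ r.domain Φ ∧ (∀ x ∈ r.domain, HasFDerivWithinAt Φ (Φ' x) r.domain x) ∧ Set.InjOn Φ r.domain ∧ r'.domain = Φ '' r.domain ∧ (∀ x ∈ r.domain, r.integrand x = r'.integrand (Φ x) * |(Φ' x).det|) ∧ (∀ x ∈ r.domain, Φ x 0 = x 0) ∧ c = Literature.NumberTheory.Transcendental.KZ.of r - Literature.NumberTheory.Transcendental.KZ.of r'} ∪ {c | c ∈ Literature.NumberTheory.Transcendental.KZ.newtonLeibnizRel ∧ ∃ (n : ℕ) (r : Literature.NumberTheory.Transcendental.KZ.IntegralRep (n + 2)) (r' : Literature.NumberTheory.Transcendental.KZ.IntegralRep (n + 1)), c = Literature.NumberTheory.Transcendental.KZ.of r - Literature.NumberTheory.Transcendental.KZ.of r'}), CT c ∈ Literature.NumberTheory.Transcendental.KZ.relations) ∧ (∀ (n : ℕ)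 (R : Literature.NumberTheory.Transcendental.KZ.IntegralRep (n + 1)) (r₀ g : Literature.NumberTheory.Transcendental.KZ.IntegralRep n), ((∃ ε > (0 : ℝ), ∀ z ∈ R.domain, 0 < z 0 → z 0 < ε → (fun i : Fin n => z i.succ) ∈ g.domain ∧ |R.integrand z| ≤ g.integrand (fun i : Fin n => z i.succ)) ∧ (∀ᵐ x : Fin n → ℝ, ∀ᶠ s in nhdsWithin (0 : ℝ) (Set.Ioi 0), (Matrix.vecCons s x ∈ R.domain ↔ x ∈ r₀.domain)) ∧ (∀ᵐ x : Fin n → ℝ, x ∈ r₀.domain → Filter.Tendsto (fun s : ℝ => R.integrand (Matrix.vecCons s x)) (nhdsWithin 0 (Set.Ioi 0)) (nhds (r₀.integrand x)))) → CT (Literature.NumberTheory.Transcendental.KZ.of R) - Literature.NumberTheory.Transcendental.KZ.of r₀ ∈ Literature.NumberTheory.Transcendental.KZ.relations)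

/-- item stmt-KontsevichZagierPeriods-3496 · crux · rank 3 · open · by planner
why it might fail: In fibre dimension ≥ 2 reaching the normal form may require un-nesting inner integrals, i.e. non-semialgebraic (log) primitives — barrier noSemialgebraicPrimitive_inv_sub_two; HK avoid this only because their inner integrals are classes, not functions.
sources: ComteLionRolin2000, LionRolin1998, CluckersMiller2011, Kaiser2017, HrushovskiKazhdan2006, Yin2018TConvexIntegration
[crux] CLASS-VALUED COMTE–LION–ROLIN (existence half of CT, CT-free, transcendence-free). For every
(n+1)-dim integral representation R (a family over s = z 0) there are D, G ∈ FormalRep with [R] − D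
− G in the subgroup generated by the FIBRED move generators (same generator set as in
CTConstruction/CT2), where D = Σ_i m_i [P_i] is a ℤ-combination of ELEMENTARY DIVERGENT PRODUCT
families P_i — coordinates (s, u, y_1..y_b, w): 0 < s < 1, 0 < u with u^q s^p < 1 (∫du = s^{-p/q}),
s ≤ y_j ≤ 1 with integrand Π 1/y_j (∫ = (log 1/s)^b), w ∈ r_i.domain with integrand r_i.integrand (a
fixed representation of any dimension d_i), subject to q > 0 and (p > 0 or b > 0), so that the slice
value is exactly s^{-p/q}(log 1/s)^b · r_i.value — and G = Σ_i m_i [S_i] is a ℤ-combination of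
DOMINATED families (same domination/special-fibre clauses as CT3). Reading: every semialgebraic
period family splits, by fibred moves with divergent intermediates allowed, into 'divergent
monomials with period coefficients given AS REPRESENTATIONS' plus a part that specialises by
dominated convergence; cross terms like log(1/s)·o(1) are dominated families with null special fibre
(checked by hand on ([0,1]², dx dy/((x+ -/
@[route_item "route-KontsevichZagierPeriods-ValuedFieldSpecialisation", crux]
def ClassLevelExpansion : Prop :=
  ∀ (n : ℕ) (R : Literature.NumberTheory.Transcendental.KZ.IntegralRep (n + 1)), ∃ (D G : Literature.NumberTheory.Transcendental.KZ.FormalRep), (∃ (k : ℕ) (m : Fin k → ℤ) (p q b d : Fin k → ℕ) (r : (i : Fin k) → Literature.NumberTheory.Transcendental.KZ.IntegralRep (d i)) (P : (i : Fin k) → Literature.NumberTheory.Transcendental.KZ.IntegralRep (b i + d i + 1 + 1)), (∀ i, 0 < q i ∧ (0 < p i ∨ 0 < b i) ∧ (P i).domain = {z | ∃ (s u : ℝ) (y : Fin (b i) → ℝ) (w : Fin (d i) → ℝ), z = Matrix.vecCons s (Matrix.vecCons u (Fin.append y w)) ∧ 0 < s ∧ s < 1 ∧ 0 < u ∧ u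 ^ (q i) * s ^ (p i) < 1 ∧ (∀ j, s ≤ y j ∧ y j ≤ 1) ∧ w ∈ (r i).domain} ∧ (P i).integrand = fun z => (∏ j : Fin (b i), (z (Fin.castAdd (d i) j).succ.succ)⁻¹) * (r i).integrand (fun l : Fin (d i) => z (Fin.natAdd (b i) l).succ.succ)) ∧ D = ∑ i, m i • Literature.NumberTheory.Transcendental.KZ.of (P i)) ∧ (∃ (k : ℕ) (d : Fin k → ℕ) (m : Fin k → ℤ) (S : (i : Fin k) → Literature.NumberTheory.Transcendental.KZ.IntegralRep (d i + 1)) (r₀ g : (i : Fin k) → Literature.NumberTheory.Transcendental.KZ.IntegralRep (d i)), (∀ i, ((∃ ε > (0 : ℝ), ∀ z ∈ (S i).domain, 0 < z 0 → z 0 < ε → (fun i : Fin (d i) => z i.succ) ∈ (g i).domain ∧ |(S i).integrand z| ≤ (g i).integrand (fun i : Fin (d i) => z i.succ)) ∧ (∀ᵐ x : Fin (d i) → ℝ, ∀ᶠ s in nhdsWithin (0 : ℝ) (Set.Ioi 0), (Matrix.vecCons s x ∈ (S i).domain ↔ x ∈ (r₀ i).domain)) ∧ (∀ᵐ x : Fin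 (d i) → ℝ, x ∈ (r₀ i).domain → Filter.Tendsto (fun s : ℝ => (S i).integrand (Matrix.vecCons s x)) (nhdsWithin 0 (Set.Ioi 0)) (nhds ((r₀ i).integrand x))))) ∧ G = ∑ i, m i • Literature.NumberTheory.Transcendental.KZ.of (S i)) ∧ Literature.NumberTheory.Transcendental.KZ.of R - D - G ∈ AddSubgroup.closure (Literature.NumberTheory.Transcendental.KZ.domainAddRel ∪ Literature.NumberTheory.Transcendental.KZ.integrandAddRel ∪ {c | ∃ (n : ℕ) (r r' : Literature.NumberTheory.Transcendental.KZ.IntegralRep (n + 1)) (Φ : (Fin (n + 1) → ℝ) → (Fin (n + 1) → ℝ)) (Φ' : (Fin (n + 1) → ℝ) → (Fin (n + 1) → ℝ) →L[ℝ] (Fin (n + 1) → ℝ)), Literature.NumberTheory.Transcendental.IsSemialgebraicMapOn ℚ r.domain Φ ∧ (∀ x ∈ r.domain, HasFDerivWithinAt Φ (Φ' x) r.domain x) ∧ Set.InjOn Φ r.domain ∧ r'.domain = Φ '' r.domain ∧ (∀ x ∈ r.domain, r.integrand x = r'.integrand (Φ x) * |(Φ' x).det|) ∧ (∀ x ∈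 r.domain, Φ x 0 = x 0) ∧ c = Literature.NumberTheory.Transcendental.KZ.of r - Literature.NumberTheory.Transcendental.KZ.of r'} ∪ {c | c ∈ Literature.NumberTheory.Transcendental.KZ.newtonLeibnizRel ∧ ∃ (n : ℕ) (r : Literature.NumberTheory.Transcendental.KZ.IntegralRep (n + 2)) (r' : Literature.NumberTheory.Transcendental.KZ.IntegralRep (n + 1)), c = Literature.NumberTheory.Transcendental.KZ.of r - Literature.NumberTheory.Transcendental.KZ.of r'})

/-- item stmt-KontsevichZagierPeriods-3497 · crux · rank 4 · open · by planner
why it might fail: Comte–Lion–Rolin produce coefficients via preparation theorems with globally subanalytic units; for ℚ-semialgebraic input the constant term is a priori an integral of L_an-definable data, not visibly ℚ-semialgebraic.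
sources: ComteLionRolin2000, Kaiser2017, CluckersMiller2011, KontsevichZagier2001
[crux] VALUE SHADOW (cheapest informative test; implied by CTConstruction via x := CT [R], and by
ClassLevelExpansion). If the slice integral of an (n+1)-dim ℚ-semialgebraic integral representation
has a divergent-monomial expansion with constant term c as s → 0⁺, then c = KZ.eval x for some
formal ℤ-combination x of integral representations (equivalently c is a difference of two real
periods, hence a real period). 'Regularised values of semialgebraic period families are periods.'
For ALGEBRAIC families this is the folklore 'periods of the limit mixed Hodge structure are
periods'; for the semialgebraic s^a(log s)^b expansions of ComteLionRolin2000/Kaiser2017 no printed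
statement was found (crossref/zbMATH/galaxy searched 2026-08-15). Expected proof: value-level
ClassLevelExpansion (Comte–Lion–Rolin with the preparation kept ℚ-semialgebraic: van den
Dries–Speissegger o-minimal preparation in the semialgebraic structure, or HK/Yin RES-classes which
are ℚ-semialgebraic because the residue field of dcl(ℚ(t)) is the real algebraic numbers).
[difficulty: L] -/
@[route_item "route-KontsevichZagierPeriods-ValuedFieldSpecialisation"]
def ConstantTermsArePeriods : Prop :=
  ∀ (n : ℕ) (R : Literature.NumberTheory.Transcendental.KZ.IntegralRep (n + 1)) (c : ℝ), (∃ (k : ℕ) (a : Fin k → ℚ) (b : Fin k → ℕ) (w : Fin k → ℝ), (∀ i, a i < 0 ∨ (a i = 0 ∧ 0 < b i)) ∧ Filter.Tendsto (fun s : ℝ => (∫ x in {x : Fin n → ℝ | Matrix.vecCons s x ∈ R.domain}, R.integrand (Matrix.vecCons s x)) - ∑ i, w i * s ^ ((a i : ℚ) : ℝ) * Real.log s ^ (b i)) (nhdsWithin 0 (Set.Ioi 0)) (nhds c)) → ∃ x : Literature.NumberTheory.Transcendental.KZ.FormalRep, Literature.NumberTheory.Transcendental.KZ.eval x = c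

/-- item stmt-KontsevichZagierPeriods-3498 · crux · rank 5 · open · by planner
why it might fail: Of Conjecture-1 / Grothendieck-period-conjecture strength in general (strength barriers kzConjecture_implies_* apply); exactness may force error families that are neither dominated nor fibred-null, needing the kernel conjecture one weight down.
sources: KontsevichZagier2001, Ayoub2015, AyoubRelKZRevisited, HuberMullerStach2017
[crux] OPEN CORE (≈ Conjecture 1; implied by it with G := 0, so not stronger than the summit). For
rational representations r, r' with equal value there is G in the subgroup of FormalRep generated by
the FIBRED move generators (as in CT2) whose NET expression is a ℤ-combination Σ m_i [R_i] of
DOMINATED families (clauses of CT3) whose special fibres satisfy Σ m_i [r₀_i] − ([r] − [r']) ∈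
KZ.relations. Reading: deform the pair into families R → r, R' → r' (tame truncations, inserted
parameter) and connect R_s to R'_s UNIFORMLY in s by moves whose intermediates may diverge as s → 0⁺
(they cancel inside G); error families must be dominated with null special fibre or be folded into
the chain. This is the families philosophy of Ayoub2015 (relative KZ) and of the sibling cards
limit-is-a-move / chains-have-standard-parts, with the one difference this route exists for:
divergent intermediates are legal. Sector instances to attach as --supports lemmas rather than
items: regularised double shuffle for MZV simplex representations (Grothendieck route items
0275-type), Legendre's relation via k → 0 (Grothendieck 0280), Euler's ζ(2,1) = ζ(3) via the
ζ(1)-regularised double shuffle (has an indepen -/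
@[route_item "route-KontsevichZagierPeriods-ValuedFieldSpecialisation", crux]
def ParametricLifting : Prop :=
  ∀ ⦃n m : ℕ⦄ (r : Literature.NumberTheory.Transcendental.KZ.IntegralRep n) (r' : Literature.NumberTheory.Transcendental.KZ.IntegralRep m), r.IsRational → r'.IsRational → r.value = r'.value → ∃ G ∈ AddSubgroup.closure (Literature.NumberTheory.Transcendental.KZ.domainAddRel ∪ Literature.NumberTheory.Transcendental.KZ.integrandAddRel ∪ {c | ∃ (n : ℕ) (r r' : Literature.NumberTheory.Transcendental.KZ.IntegralRep (n + 1)) (Φ : (Fin (n + 1) → ℝ) → (Fin (n + 1) → ℝ)) (Φ' : (Fin (n + 1) → ℝ) → (Fin (n + 1) → ℝ) →L[ℝ] (Fin (n + 1) → ℝ)), Literature.NumberTheory.Transcendental.IsSemialgebraicMapOn ℚ r.domain Φ ∧ (∀ x ∈ r.domain, HasFDerivWithinAt Φ (Φ' x) r.domain x) ∧ Set.InjOn Φ r.domain ∧ r'.domain = Φ '' r.domain ∧ (∀ x ∈ r.domain, r.integrand x = r'.integrand (Φ x) * |(Φ' x).det|) ∧ (∀ x ∈ r.domain, Φ x 0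 = x 0) ∧ c = Literature.NumberTheory.Transcendental.KZ.of r - Literature.NumberTheory.Transcendental.KZ.of r'} ∪ {c | c ∈ Literature.NumberTheory.Transcendental.KZ.newtonLeibnizRel ∧ ∃ (n : ℕ) (r : Literature.NumberTheory.Transcendental.KZ.IntegralRep (n + 2)) (r' : Literature.NumberTheory.Transcendental.KZ.IntegralRep (n + 1)), c = Literature.NumberTheory.Transcendental.KZ.of r - Literature.NumberTheory.Transcendental.KZ.of r'}), (∃ (k : ℕ) (d : Fin k → ℕ) (m : Fin k → ℤ) (R : (i : Fin k) → Literature.NumberTheory.Transcendental.KZ.IntegralRep (d i + 1)) (r₀ g : (i : Fin k) → Literature.NumberTheory.Transcendental.KZ.IntegralRep (d i)), (∀ i, ((∃ ε > (0 : ℝ), ∀ z ∈ (R i).domain, 0 < z 0 → z 0 < ε → (fun i : Fin (d i) => z i.succ) ∈ (g i).domain ∧ |(R i).integrand z| ≤ (g i).integrand (fun i : Fin (d i) => z i.succ)) ∧ (∀ᵐ x : Fin (d i) → ℝ, ∀ᶠ s in nhdsWithin (0 : ℝ) (Set.Ioi 0), (Matrix.vecCons s x ∈ (R i).domain ↔ x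 ∈ (r₀ i).domain)) ∧ (∀ᵐ x : Fin (d i) → ℝ, x ∈ (r₀ i).domain → Filter.Tendsto (fun s : ℝ => (R i).integrand (Matrix.vecCons s x)) (nhdsWithin 0 (Set.Ioi 0)) (nhds ((r₀ i).integrand x))))) ∧ G = ∑ i, m i • Literature.NumberTheory.Transcendental.KZ.of (R i) ∧ (∑ i, m i • Literature.NumberTheory.Transcendental.KZ.of (r₀ i)) - (Literature.NumberTheory.Transcendental.KZ.of r - Literature.NumberTheory.Transcendental.KZ.of r') ∈ Literature.NumberTheory.Transcendental.KZ.relations)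

/-- item stmt-KontsevichZagierPeriods-3500 · support · rank 9 · closed · proved by Summit.KontsevichZagierPeriods.ValuedFieldSpecialisation.fibredRelationsLeRelations_proof (prover) · by planner
sources: KontsevichZagier2001
[support] Fibred chains are chains: the subgroup generated by the fibred move generators (CT2's set)
is contained in KZ.relations. Provable now (~20 lines): AddSubgroup.closure_le;
domainAddRel/integrandAddRel ⊆ relations (KZ.*_subset_relations), a fibred change-of-variables
instance is a changeOfVariablesRel instance (drop the clause Φ z 0 = z 0), the fibred Newton–Leibniz
set is a subset of newtonLeibnizRel by its first conjunct. Calibrates that the inlined generator set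
parses as intended. -/
@[route_item "route-KontsevichZagierPeriods-ValuedFieldSpecialisation"]
def FibredRelationsLeRelations : Prop :=
  AddSubgroup.closure (Literature.NumberTheory.Transcendental.KZ.domainAddRel ∪ Literature.NumberTheory.Transcendental.KZ.integrandAddRel ∪ {c | ∃ (n : ℕ) (r r' : Literature.NumberTheory.Transcendental.KZ.IntegralRep (n + 1)) (Φ : (Fin (n + 1) → ℝ) → (Fin (n + 1) → ℝ)) (Φ' : (Fin (n + 1) → ℝ) → (Fin (n + 1) → ℝ) →L[ℝ] (Fin (n + 1) → ℝ)), Literature.NumberTheory.Transcendental.IsSemialgebraicMapOn ℚ r.domain Φ ∧ (∀ x ∈ r.domain, HasFDerivWithinAt Φ (Φ' x) r.domain x) ∧ Set.InjOn Φ r.domain ∧ r'.domain = Φ '' r.domain ∧ (∀ x ∈ r.domain, r.integrand x = r'.integrand (Φ x) * |(Φ' x).det|) ∧ (∀ x ∈ r.domain, Φ x 0 = x 0) ∧ c = Literature.NumberTheory.Transcendental.KZ.of r - Literature.NumberTheory.Transcendental.KZ.of r'} ∪ {c | c ∈ Literature.NumberTheory.Transcendental.KZ.newtonLeibnizRel ∧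 ∃ (n : ℕ) (r : Literature.NumberTheory.Transcendental.KZ.IntegralRep (n + 2)) (r' : Literature.NumberTheory.Transcendental.KZ.IntegralRep (n + 1)), c = Literature.NumberTheory.Transcendental.KZ.of r - Literature.NumberTheory.Transcendental.KZ.of r'}) ≤ Literature.NumberTheory.Transcendental.KZ.relations

/-- item stmt-KontsevichZagierPeriods-3501 · support · rank 9 · closed · proved by Summit.KontsevichZagierPeriods.ValuedFieldSpecialisation.constantTermUnique_proof @ 03879ea40685 (prover) · by planner
sources: ComteLionRolin2000
[support] Uniqueness of the constant term: two divergent-monomial expansions of the same slice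
function have the same constant term (so CT1 is well posed). Provable now (~150 lines): subtract; a
finite ℝ-combination of distinct monomials s^a (log s)^b with a < 0 or a = 0 < b that tends to a
finite limit as s → 0⁺ has all coefficients zero — order the monomials by growth (smallest a, then
largest b), divide by the dominant one (Real.tendsto_log_nhdsWithin_zero, rpow/log comparison
isLittleO lemmas in Mathlib.Analysis.SpecialFunctions.Pow.Asymptotics), induct on the number of
monomials after merging equal exponents. -/
@[route_item "route-KontsevichZagierPeriods-ValuedFieldSpecialisation"]
def ConstantTermUnique : Prop :=
  ∀ (n : ℕ) (R : Literature.NumberTheory.Transcendental.KZ.IntegralRep (n + 1)) (c c' : ℝ), (∃ (k : ℕ) (a : Fin k → ℚ) (b : Fin k → ℕ) (w : Fin k → ℝ), (∀ i, a i < 0 ∨ (a i = 0 ∧ 0 < b i)) ∧ Filter.Tendsto (fun s : ℝ => (∫ x in {x : Fin n → ℝ | Matrix.vecCons s x ∈ R.domain}, R.integrand (Matrix.vecCons s x)) - ∑ i, w i * s ^ ((a i : ℚ) : ℝ) * Real.log s ^ (b i)) (nhdsWithin 0 (Set.Ioi 0)) (nhds c)) → (∃ (k : ℕ) (a : Fin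 k → ℚ) (b : Fin k → ℕ) (w : Fin k → ℝ), (∀ i, a i < 0 ∨ (a i = 0 ∧ 0 < b i)) ∧ Filter.Tendsto (fun s : ℝ => (∫ x in {x : Fin n → ℝ | Matrix.vecCons s x ∈ R.domain}, R.integrand (Matrix.vecCons s x)) - ∑ i, w i * s ^ ((a i : ℚ) : ℝ) * Real.log s ^ (b i)) (nhdsWithin 0 (Set.Ioi 0)) (nhds c')) → c = c'

/-- item stmt-KontsevichZagierPeriods-3502 · support · rank 9 · closed · proved by Summit.KontsevichZagierPeriods.ValuedFieldSpecialisation.dominatedSliceTendsto_proof @ 0ea98118b10f (prover) · by planner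
sources: Kaiser2017
[support] Dominated families specialise at value level: under the domination/special-fibre clauses
of CT3 the slice integral I_R(s) tends to r₀.value as s → 0⁺ (so CT3 is consistent with CT1, and
HasConstantTerm R r₀.value holds with no divergent monomials). Provable now (~120 lines):
MeasureTheory.tendsto_integral_filter_of_dominated_convergence along nhdsWithin 0 (Ioi 0) (countably
generated) for f_s = indicator of the slice · R.integrand ∘ vecCons s, bound = indicator g.domain ·
g.integrand (g.integrableOn), measurability of slices from IntegralRep.measurableSet_domain_holds
and IsSemialgebraicFunOn.measurable_holds composed with the continuous map x ↦ vecCons s x, a.e.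
limit from the two a.e. clauses; integral_indicator to return to set integrals. -/
@[route_item "route-KontsevichZagierPeriods-ValuedFieldSpecialisation"]
def DominatedSliceTendsto : Prop :=
  ∀ (n : ℕ) (R : Literature.NumberTheory.Transcendental.KZ.IntegralRep (n + 1)) (r₀ g : Literature.NumberTheory.Transcendental.KZ.IntegralRep n), ((∃ ε > (0 : ℝ), ∀ z ∈ R.domain, 0 < z 0 → z 0 < ε → (fun i : Fin n => z i.succ) ∈ g.domain ∧ |R.integrand z| ≤ g.integrand (fun i : Fin n => z i.succ)) ∧ (∀ᵐ x : Fin n → ℝ, ∀ᶠ s in nhdsWithin (0 : ℝ) (Set.Ioi 0), (Matrix.vecCons s x ∈ R.domain ↔ x ∈ r₀.domain)) ∧ (∀ᵐ x : Fin n → ℝ, x ∈ r₀.domain → Filter.Tendsto (fun s : ℝ => R.integrand (Matrix.vecCons s x)) (nhdsWithin 0 (Set.Ioi 0)) (nhds (r₀.integrand x)))) → Filter.Tendsto (fun s : ℝ => (∫ x in {x : Fin n → ℝ | Matrix.vecCons s x ∈ R.domain}, R.integrand (Matrix.vecCons s x))) (nhdsWithin 0 (Set.Ioi 0)) (nhds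 r₀.value)

/-- item stmt-KontsevichZagierPeriods-3503 · support · rank 9 · open · by planner
sources: LionRolin1998, ComteLionRolin2000, Kaiser2017
[support] ClassLevelExpansion for families of ONE-dimensional representations (R : IntegralRep
(1+1), slices in ℝ): the Puiseux / semialgebraic-preparation case, expected provable with effort
(cell decomposition of R.domain ⊆ ℝ² over the s-axis, semialgebraic preparation of the integrand on
each cell as a(s)·|x − θ(s)|^λ·unit, fibred substitutions x ↦ x − θ(s), x ↦ x/s^γ, splitting off
x^{-1}-type and x^{λ}, λ < −1, monomials as elementary families, Taylor-splitting units so the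
remainders are dominated by x^{1/N−1}-type integrable envelopes — all worked instances in the crux
text behave). CALIBRATION of the encodings (elementary product families with the padding coordinate
u, dominated clauses): if this item fails for an encoding reason rather than a mathematical one,
report to the planner for a restate — that is not a refutation of the line. A genuine counterexample
here closes the route (kill criterion). -/
@[route_item "route-KontsevichZagierPeriods-ValuedFieldSpecialisation"]
def ClassLevelExpansionFibreDimOne : Prop :=
  ∀ (R : Literature.NumberTheory.Transcendental.KZ.IntegralRep (1 + 1)), ∃ (D G : Literature.NumberTheory.Transcendental.KZ.FormalRep), (∃ (k : ℕ) (m : Fin k → ℤ) (p q b d : Fin k → ℕ) (r : (i : Fin k) → Literature.NumberTheory.Transcendental.KZ.IntegralRep (d i)) (P : (i : Fin k) → Literature.NumberTheory.Transcendental.KZ.IntegralRep (b i + d i + 1 + 1)), (∀ i, 0 < q i ∧ (0 < p i ∨ 0 < b i) ∧ (P i).domain = {z | ∃ (s u : ℝ) (y : Fin (b i) → ℝ) (w : Fin (d i) → ℝ), z = Matrix.vecCons s (Matrix.vecCons u (Fin.append y w)) ∧ 0 < s ∧ s < 1 ∧ 0 < u ∧ u ^ (q i) * s ^ (p i) < 1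 ∧ (∀ j, s ≤ y j ∧ y j ≤ 1) ∧ w ∈ (r i).domain} ∧ (P i).integrand = fun z => (∏ j : Fin (b i), (z (Fin.castAdd (d i) j).succ.succ)⁻¹) * (r i).integrand (fun l : Fin (d i) => z (Fin.natAdd (b i) l).succ.succ)) ∧ D = ∑ i, m i • Literature.NumberTheory.Transcendental.KZ.of (P i)) ∧ (∃ (k : ℕ) (d : Fin k → ℕ) (m : Fin k → ℤ) (S : (i : Fin k) → Literature.NumberTheory.Transcendental.KZ.IntegralRep (d i + 1)) (r₀ g : (i : Fin k) → Literature.NumberTheory.Transcendental.KZ.IntegralRep (d i)), (∀ i, ((∃ ε > (0 : ℝ), ∀ z ∈ (S i).domain, 0 < z 0 → z 0 < ε → (fun i : Fin (d i) => z i.succ) ∈ (g i).domain ∧ |(S i).integrand z| ≤ (g i).integrand (fun i : Fin (d i) => z i.succ)) ∧ (∀ᵐ x : Fin (d i) → ℝ, ∀ᶠ s in nhdsWithin (0 : ℝ) (Set.Ioi 0), (Matrix.vecCons s x ∈ (S i).domain ↔ x ∈ (r₀ i).domain)) ∧ (∀ᵐ x : Fin (d i) → ℝ, x ∈ (r₀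 i).domain → Filter.Tendsto (fun s : ℝ => (S i).integrand (Matrix.vecCons s x)) (nhdsWithin 0 (Set.Ioi 0)) (nhds ((r₀ i).integrand x))))) ∧ G = ∑ i, m i • Literature.NumberTheory.Transcendental.KZ.of (S i)) ∧ Literature.NumberTheory.Transcendental.KZ.of R - D - G ∈ AddSubgroup.closure (Literature.NumberTheory.Transcendental.KZ.domainAddRel ∪ Literature.NumberTheory.Transcendental.KZ.integrandAddRel ∪ {c | ∃ (n : ℕ) (r r' : Literature.NumberTheory.Transcendental.KZ.IntegralRep (n + 1)) (Φ : (Fin (n + 1) → ℝ) → (Fin (n + 1) → ℝ)) (Φ' : (Fin (n + 1) → ℝ) → (Fin (n + 1) → ℝ) →L[ℝ] (Fin (n + 1) → ℝ)), Literature.NumberTheory.Transcendental.IsSemialgebraicMapOn ℚ r.domain Φ ∧ (∀ x ∈ r.domain, HasFDerivWithinAt Φ (Φ' x) r.domain x) ∧ Set.InjOn Φ r.domain ∧ r'.domain = Φ '' r.domain ∧ (∀ x ∈ r.domain, r.integrand x = r'.integrand (Φ x) * |(Φ' x).det|) ∧ (∀ x ∈ r.domain, Φ x 0 = x 0) ∧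 c = Literature.NumberTheory.Transcendental.KZ.of r - Literature.NumberTheory.Transcendental.KZ.of r'} ∪ {c | c ∈ Literature.NumberTheory.Transcendental.KZ.newtonLeibnizRel ∧ ∃ (n : ℕ) (r : Literature.NumberTheory.Transcendental.KZ.IntegralRep (n + 2)) (r' : Literature.NumberTheory.Transcendental.KZ.IntegralRep (n + 1)), c = Literature.NumberTheory.Transcendental.KZ.of r - Literature.NumberTheory.Transcendental.KZ.of r'})

/-- item stmt-KontsevichZagierPeriods-3499 · assembly · rank 1 · closed · proved by Summit.KontsevichZagierPeriods.ValuedFieldSpecialisation.assembly_proof @ 360292163840 (prover) · by planner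
sources: KontsevichZagier2001
[assembly] CTConstruction → ParametricLifting → KontsevichZagierPeriods. Proof (pure algebra, ≤ 60
lines once the inlined clauses are matched syntactically — they are copied verbatim between the
items): given rational r, r' with equal value, ParametricLifting gives G ∈ closure(fibred
generators) with G = Σ m_i [R_i], R_i dominated with special fibres r₀_i and Σ m_i [r₀_i] − ([r] −
[r']) ∈ relations; CT2 + AddSubgroup.closure_le (preimage of relations under the hom CT) gives CT G
∈ relations; additivity of CT and CT3 give CT G − Σ m_i [r₀_i] ∈ relations; hence [r] − [r'] ∈
relations, i.e. KZ.Equivalent r r', which is the summit unfolded (KontsevichZagierPeriods_iff). -/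
@[route_item "route-KontsevichZagierPeriods-ValuedFieldSpecialisation"]
def Assembly : Prop :=
  CTConstruction → ParametricLifting → KontsevichZagierPeriods

-- records of items no longer active in this route (dropped / restated):
-- earlier Target (stmt-KontsevichZagierPeriods-3494, replaced 2026-08-15T11:20:56Z -> stmt-KontsevichZagierPeriods-3596): retired by None — CTConstruction ∧ ParametricLifting

/-! D-0027 §2.1 — DECIDING THEOREM (planner-authored via `route open/edit --closes-file`; by planner-rbadge-KontsevichZagierPeriods-ValuedF-23ce9ca4-g2-0 2026-08-15T16:13:54Z):
its hypotheses are this route's items and its conclusion the sub-problem Statement (glue_lint), and it elaborates with this file. -/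

@[closes "route-KontsevichZagierPeriods-ValuedFieldSpecialisation"] theorem closes (h₁ : CTConstruction) (h₂ : ParametricLifting) : KontsevichZagierPeriods := by
  intro n m r r' hr hr' hval
  change Literature.NumberTheory.Transcendental.KZ.of r - Literature.NumberTheory.Transcendental.KZ.of r' ∈
    Literature.NumberTheory.Transcendental.KZ.relations
  obtain ⟨CT, -, hCT2, hCT3⟩ := h₁
  obtain ⟨G, hG, k, d, c, R, r₀, g, hdom, rfl, hfib⟩ := h₂ r r' hr hr' hval
  -- (CT2) fibred move generators go to relations, hence so does the whole fibred subgroup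
  have hCTG : CT (∑ i, c i • Literature.NumberTheory.Transcendental.KZ.of (R i)) ∈
      Literature.NumberTheory.Transcendental.KZ.relations := by
    have hle : AddSubgroup.closure _ ≤ Literature.NumberTheory.Transcendental.KZ.relations.comap CT :=
      (AddSubgroup.closure_le _).mpr fun x hx => AddSubgroup.mem_comap.mpr (hCT2 x hx)
    exact AddSubgroup.mem_comap.mp (hle hG)
  -- (CT3) each dominated family specialises to its special fibre, modulo relations
  have hCTG' : CT (∑ i, c i • Literature.NumberTheory.Transcendental.KZ.of (R i)) -
      ∑ i, c i • Literature.NumberTheory.Transcendental.KZ.of (r₀ i) ∈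
      Literature.NumberTheory.Transcendental.KZ.relations := by
    rw [map_sum, ← Finset.sum_sub_distrib]
    refine sum_mem fun i _ => ?_
    rw [map_zsmul, ← zsmul_sub]
    exact AddSubgroup.zsmul_mem _ (hCT3 (d i) (R i) (r₀ i) (g i) (hdom i)) (c i)
  -- algebra in FormalRep / relations: [r] - [r'] = Σ mᵢ[r₀ᵢ] - (Σ mᵢ[r₀ᵢ] - ([r] - [r']))
  have h3 := Literature.NumberTheory.Transcendental.KZ.relations.sub_mem hCTG hCTG'
  rw [sub_sub_cancel] at h3
  have h4 := Literature.NumberTheory.Transcendental.KZ.relations.sub_mem h3 hfib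
  rwa [sub_sub_cancel] at h4

end Summit.KontsevichZagierPeriods.KontsevichZagierPeriods.Theses.ValuedFieldSpecialisation
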